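import Summits.QuantumFields.YangMills.Theorems.GronwallGapContinuumFromLatticeGapDecayOfUniformDensity
import Summits.QuantumFields.YangMills.Theorems.MirrorModularBoostsHypercubicLimitOfLineInputs
import Summits.QuantumFields.YangMills.Theorems.ScalingWindowSplitExistenceLegFromLattice
import HarnessLib

/-!
# `ContinuumFromLatticeGap` (stmt-QuantumFields-15915), line `registered`, reshape 6: the closure and the seam over the
# UNIFORM-monomial hypotheses (`stub_oneFieldClausesUniform`)

Support file for the crux item stmt-QuantumFields-15915 (`GronwallGap.ContinuumFromLatticeGap`), reshape 6 of line
`registered` (the RP-spectral conjunct (b) ELIMINATED).  The twins of the landed reshape-5 closure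
`oneFieldClauses_of_uniformMomentBoundsPlanes_local` and seam `oneField_of_latticeInequalities_local` in which the LOCAL
RP-spectral hypothesis is REPLACED by what the new decay leg `stub_decayOfUniformMonomials` consumes: ONE clustering
constant `Cmono n d ≥ 1` per (arity, box) for the reflected diagonal pairs of plaquette monomials on the scheme's own tori at
rate `Δ a_k` (the UNIFORM output of the lock, per pair) and its absorption by the volumes
(`(log Cmono(n,⌊ρ/a_k⌋+2) + |log a_k|)/(a_k L_k) → 0`).  The decay rate becomes `Δ/2`; the uniform lattice gap is weakened
accordingly (`cclgSplit_hasLatticeMassGap_mono`).  Everything else is verbatim the landed proofs.  No definitions, no named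
facts.  Refs: GlimmJaffe1987 §6.1, §19.1; OsterwalderSeiler1978 §§2–3.
-/


noncomputable section

open scoped SchwartzMap BigOperators Topology Classical MeasureTheory ProbabilityTheory Matrix
open MeasureTheory ProbabilityTheory Filter Topology
open Literature.MathematicalPhysics.AQFT Literature.MathematicalPhysics.QuantumLattice
open Literature.MathematicalPhysics.QuantumFieldTheory
open Summit.QuantumFields.YangMills.Cruxes.HypercubicLimit.CouplingResponse
open Summit.QuantumFields.YangMills.Cruxes.OSLegsFromFemtoAndGap.DlrCollarTransfer (plane conn Decay RPPos ConnCS)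
open Summit.QuantumFields.YangMills.Theorems.WeakCouplingHypercubicLimit.TraceNormColdPressure
  (reflHalf_of_pieces stub_rpPosOfPlaneLimits stub_signedPermOfPlaneLimits)
open Summit.QuantumFields.YangMills.Theorems.ScalingWindowSplit
  (trunc_rescale tsupport_thetaTest_pos' uniformMomentBoundsPlanes_subseq)

namespace Summit.QuantumFields.YangMills.Theorems.ContinuumFromLatticeGap

/-! ## The closure of the one-field clauses over the LOCAL class -/

section Chain

variable {G : Type} [Group G] [TopologicalSpace G] [IsTopologicalGroup G] [CompactSpace G]
  [MeasurableSpace G] [BorelSpace G]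

/-- **The closure of the existence leg from its landed pieces, over the UNIFORM-monomial hypotheses** (reshape-6 twin of
`oneFieldClauses_of_uniformMomentBoundsPlanes_local`: conjunct (b) replaced by the monomial clustering constants along the scheme
and their absorption by the volumes; continuum rate `Δ/2`): a weak-coupling scheme with polynomial volume growth and renormalisation, bounded
counterterms, the `k`-uniform plane-resolved `n!`-moment bounds, the uniform lattice gap at rate `Δ`, LOCAL RP-spectral
monomial constants at rate `Δ a_k` absorbed by the volumes, and the non-triviality and `κ₃` floors yield a sub-scheme (still at
weak coupling) and a one-field family with `OneFieldClauses`.  Chain (all landed): functional bounds ⇒ plane limits ⇒ soft half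
(gap weakened to `Δ/2`) ∧ reflection half (`reflHalf_of_pieces` fed `stub_rpPosOfPlaneLimits`, `stub_signedPermOfPlaneLimits` and
the NEW decay leg `stub_decayOfUniformMonomials`) ⇒ `oneFieldClauses_of_halves`.
-- adapted from Theorems/GronwallGapContinuumFromLatticeGapOneFieldLocal.lean [folklore] -/
theorem oneFieldClauses_of_uniformMonomials
    (r : LatticeRep G) (sch : SpeciesScheme (YMSpecies G)) (hw : sch.HasWeakCouplingLimit) (hpv : PolyVolume sch)
    (hpr : PolyRenorm r sch) (hbm : ∃ Cm : ℝ, ∀ k, |sch.m r.curvature k| ≤ Cm) (hUMB : UniformMomentBoundsPlanes r sch)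
    {Δ : ℝ} (hΔ : 0 < Δ) (hgap : HasLatticeMassGap r sch Δ) (Cmono : ℕ → ℕ → ℝ) (hC1 : ∀ n d, 1 ≤ Cmono n d)
    (hmono : ∀ (n d : ℕ) (q : Fin n → Fin 4 × Fin 4) (y : Fin n → Literature.Probability.LatticeModels.Site 4),
      (∀ l, (0 ≤ y l 0 ∧ y l 0 ≤ (d : ℤ)) ∧ ∀ i : Fin 4, i ≠ 0 → |y l i| ≤ (d : ℤ)) →
      ∀ (s : Finset (Fin n)) (k j : ℕ), j ≤ sch.L k →
        latticeConnectedCorr r.ρ (sch.β k) (2 * sch.L k + 1)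
            ((fun V => ∏ l ∈ s, plane G r (q l) (y l) V) ∘ gaugeTimeReflect)
            (fun V => ∏ l ∈ s, plane G r (q l) (y l) V) j ≤ Cmono n d * Real.exp (-(Δ * sch.a k * j)))
    (habs : ∀ n ρ : ℕ, Tendsto (fun k => (Real.log (Cmono n (⌊(ρ : ℝ) / sch.a k⌋₊ + 2)) + |Real.log (sch.a k)|) /
      (sch.a k * (sch.L k : ℝ))) atTop (𝓝 0))
    (hNT : (∃ (u v : 𝓢(EuclideanSpace ℝ (Fin 4), ℝ)) (δ : ℝ),
      tsupport u ⊆ {y : EuclideanSpace ℝ (Fin 4) | y 0 < 0} ∧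
      tsupport v ⊆ {y : EuclideanSpace ℝ (Fin 4) | 0 < y 0} ∧ 0 < δ ∧
      ∀ᶠ k in atTop, δ ≤
        |latticeSchwinger r.ρ sch (fun s => s.F) k (1 + 1) (fun _ => r.curvature) ![u, v] -
          latticeSchwinger r.ρ sch (fun s => s.F) k 1 (fun _ => r.curvature) ![u] *
            latticeSchwinger r.ρ sch (fun s => s.F) k 1 (fun _ => r.curvature) ![v]|))
    (hNG : (∃ (f g h : 𝓢(EuclideanSpace ℝ (Fin 4), ℝ)) (δ : ℝ),
      Disjoint (tsupport f) (tsupport g) ∧ Disjoint (tsupport f) (tsupport h) ∧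
      Disjoint (tsupport g) (tsupport h) ∧ 0 < δ ∧
      ∀ᶠ k in atTop, δ ≤
        |latticeSchwinger r.ρ sch (fun s => s.F) k 3 (fun _ => r.curvature) ![f, g, h] -
          latticeSchwinger r.ρ sch (fun s => s.F) k 1 (fun _ => r.curvature) ![f] *
            latticeSchwinger r.ρ sch (fun s => s.F) k 2 (fun _ => r.curvature) ![g, h] -
          latticeSchwinger r.ρ sch (fun s => s.F) k 1 (fun _ => r.curvature) ![g] *
            latticeSchwinger r.ρ sch (fun s => s.F) k 2 (fun _ => r.curvature) ![f, h] -
          latticeSchwinger r.ρ sch (fun s => s.F) k 1 (fun _ => r.curvature) ![h] *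
            latticeSchwinger r.ρ sch (fun s => s.F) k 2 (fun _ => r.curvature) ![f, g] +
          2 * (latticeSchwinger r.ρ sch (fun s => s.F) k 1 (fun _ => r.curvature) ![f] *
            latticeSchwinger r.ρ sch (fun s => s.F) k 1 (fun _ => r.curvature) ![g] *
            latticeSchwinger r.ρ sch (fun s => s.F) k 1 (fun _ => r.curvature) ![h])|)) :
    ∃ (sch' : SpeciesScheme (YMSpecies G)) (S₁ : SchwingerFamily (EuclideanSpace ℝ (Fin 4))),
      sch'.HasWeakCouplingLimit ∧ OneFieldClauses r sch' S₁ := by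
  have hUFB : UniformFunctionalBoundPlanes r sch := stub_functionalBoundPlanes G r sch hpv hUMB
  obtain ⟨φ, hφ, T, hPL⟩ := stub_planeLimits G r sch hUFB
  -- the soft half on the sub-scheme
  obtain ⟨hE0, hE3⟩ := planeSum_isNormalized_isSymmetric G r sch φ T hPL
  have hE0' := planeSum_hasLinearGrowth G r sch φ T hPL
  have hconv := convergence_subseq_of_planeLimits G r sch φ hφ T hPL
  have htr := stub_translationPlanesMono G r sch φ hφ T hpv hpr hUFB hPL
  obtain ⟨u, v, δ, hu, hv, hδ, hfl⟩ := hNT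
  obtain ⟨f, g, h3, δ', hfg, hfh, hgh, hδ', hfl3⟩ := hNG
  have hNT' := nontrivialClause_of_latticeFloor G r (subseq sch φ hφ) (planeSum T) hconv
    ⟨u, v, δ, hu, hv, hδ, eventually_subseq hφ hfl⟩
  have hNG' := nonGaussianClause_of_latticeFloor G r (subseq sch φ hφ) (planeSum T) hconv
    ⟨f, g, h3, δ', hfg, hfh, hgh, hδ', eventually_subseq hφ hfl3⟩
  have hΔ2 : 0 < Δ / 2 := half_pos hΔ
  have hgap2 : HasLatticeMassGap r sch (Δ / 2) := by
    intro A B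
    obtain ⟨C₀, hC₀⟩ := hgap A B
    refine ⟨max C₀ 0, hC₀.mono fun k hk S hS n hn => (hk S hS n hn).trans ?_⟩
    have h1 : Real.exp (-(Δ * (sch.a k * n))) ≤ Real.exp (-(Δ / 2 * (sch.a k * n))) :=
      Real.exp_le_exp.2 (neg_le_neg (mul_le_mul_of_nonneg_right (by linarith)
        (mul_nonneg (sch.a_pos k).le (Nat.cast_nonneg n))))
    calc C₀ * Real.exp (-(Δ * (sch.a k * n))) ≤ max C₀ 0 * Real.exp (-(Δ * (sch.a k * n))) :=
          mul_le_mul_of_nonneg_right (le_max_left _ _) (Real.exp_pos _).le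
      _ ≤ max C₀ 0 * Real.exp (-(Δ / 2 * (sch.a k * n))) := mul_le_mul_of_nonneg_left h1 (le_max_right _ _)
  have hsoft : SoftHalf r (subseq sch φ hφ) (planeSum T) (Δ / 2) :=
    ⟨hE0, hE0', hE3, fun n _ a F hF => htr n a F hF, hconv, hNT', hNG', hasLatticeMassGap_subseq r sch φ hφ hgap2⟩
  -- the reflection half, with the decay leg from the UNIFORM monomial constants (no RP-spectral input)
  have hβ0 : ∀ᶠ k in atTop, 0 ≤ sch.β k := hw.eventually_ge_atTop 0
  have hrefl : ReflHalf (planeSum T) (Δ / 2) :=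
    reflHalf_of_pieces (planeSum T) hΔ2 hE0 (fun n _ a F hF => htr n a F hF)
      (stub_rpPosOfPlaneLimits G r sch φ hφ T hβ0 hUFB hPL)
      (stub_signedPermOfPlaneLimits G r sch φ hφ T hUFB hPL)
      (stub_decayOfUniformMonomials G r sch φ hφ T Δ Cmono hΔ hpr hbm hβ0 hUFB hPL hC1 hmono habs)
  exact ⟨subseq sch φ hφ, planeSum T, hasWeakCouplingLimit_subseq sch φ hφ hw,
    oneFieldClauses_of_halves r _ _ hΔ2 hsoft hrefl⟩

end Chain

/-! ## The renormalisation seam over the LOCAL class -/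

section Seam

variable {G : Type} [Group G] [TopologicalSpace G] [IsTopologicalGroup G] [CompactSpace G] [MeasurableSpace G]
  [BorelSpace G]

/-- **The seam over the UNIFORM-monomial hypotheses, assembled: from the lattice inequalities at one witness to the one-field
clauses** (reshape-6 twin of `oneField_of_latticeInequalities_local`: the RP-spectral hypothesis replaced by the monomial
clustering constants along the scheme and their absorption by the volumes).
Given `r`, a scheme `sch` at weak coupling with polynomial volume growth, `Δ > 0` with the uniform lattice gap and
the monomial constants, a negative-time bump `u` with the polynomial floor and the window of the BARE truncated
two-point function `T⁰_k(u, θu)`, the `k`-uniform plane-resolved moment bounds of the SELF-NORMALISED scheme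
`canon` (`c'_k = 1/√T⁰_k(u,θu)`, `m'_k = ⟨tr U_p⟩_k`) and a `κ₃` floor for `canon`: there are a sub-scheme at weak
coupling and a one-field Schwinger family with `OneFieldClauses`.  Proof: `T^canon_k(u,θu) = c'_k² T⁰_k = 1` on the
tail where the floor holds (`trunc_rescale`) gives clause (c) of `IRInputs r canon` with `v = θu`, `δ = 1`; clauses
(a), (b) are those of `sch` (they read `a, β, L` only) and (d) is the hypothesis; on the tail `k ≥ k₀` (floor and
`a_k ≤ 1`) `|c'_k| = 1/√T⁰_k ≤ a_k⁻ᵖ` (`PolyRenorm`) and `|m'_k| ≤ sup |tr F²|`; the tail sub-scheme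
`subseq canon (· + k₀)` keeps weak coupling, polynomial volumes, the moment bounds and `IRInputs`, so the landed
`oneFieldClauses_of_uniformMonomials` applies (the monomial hypotheses read `a, β, L` only and restrict to tails).
-- adapted from Theorems/GronwallGapContinuumFromLatticeGapOneFieldLocal.lean [cite: GlimmJaffe1987, §6.1 and §19.1] -/
theorem oneField_of_latticeInequalities_uniform (r : LatticeRep G) (sch : SpeciesScheme (YMSpecies G))
    (u : 𝓢(EuclideanSpace ℝ (Fin 4), ℝ)) (p : ℕ) (M Δ : ℝ) (Cmono : ℕ → ℕ → ℝ) :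
    let bare : SpeciesScheme (YMSpecies G) := { sch with c := fun _ _ => 1, m := fun _ _ => 0 }
    let T : 𝓢(EuclideanSpace ℝ (Fin 4), ℝ) → ℕ → ℝ := fun w k =>
      latticeSchwinger r.ρ bare (fun s => s.F) k (1 + 1) (fun _ => r.curvature) ![w, thetaTest 4 w] -
        latticeSchwinger r.ρ bare (fun s => s.F) k 1 (fun _ => r.curvature) ![w] *
          latticeSchwinger r.ρ bare (fun s => s.F) k 1 (fun _ => r.curvature) ![thetaTest 4 w]
    let canon : SpeciesScheme (YMSpecies G) :=
      { sch with
        c := fun _ k => (Real.sqrt (T u k))⁻¹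
        m := fun _ k => ∫ U, r.curvature.F (torusLift (sch.side k) U) ∂(wilsonMeasure r.ρ (sch.β k)) }
    sch.HasWeakCouplingLimit →
    (∃ N : ℕ, 1 ≤ N ∧ ∀ᶠ k in Filter.atTop, (sch.a k)⁻¹ ≤ (sch.a k * (sch.L k : ℝ)) ^ N) →
    0 < Δ → HasLatticeMassGap r sch Δ → (∀ n d, 1 ≤ Cmono n d) →
    (∀ (n d : ℕ) (q : Fin n → Fin 4 × Fin 4) (y : Fin n → Literature.Probability.LatticeModels.Site 4),
      (∀ l, (0 ≤ y l 0 ∧ y l 0 ≤ (d : ℤ)) ∧ ∀ i : Fin 4, i ≠ 0 → |y l i| ≤ (d : ℤ)) →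
      ∀ (s : Finset (Fin n)) (k j : ℕ), j ≤ sch.L k →
        latticeConnectedCorr r.ρ (sch.β k) (2 * sch.L k + 1)
            ((fun V => ∏ l ∈ s, plane G r (q l) (y l) V) ∘ gaugeTimeReflect)
            (fun V => ∏ l ∈ s, plane G r (q l) (y l) V) j ≤ Cmono n d * Real.exp (-(Δ * sch.a k * j))) →
    (∀ n ρ : ℕ, Tendsto (fun k => (Real.log (Cmono n (⌊(ρ : ℝ) / sch.a k⌋₊ + 2)) + |Real.log (sch.a k)|) /
      (sch.a k * (sch.L k : ℝ))) atTop (𝓝 0)) →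
    tsupport u ⊆ {y : EuclideanSpace ℝ (Fin 4) | y 0 < 0} →
    (∀ᶠ k in Filter.atTop, (sch.a k) ^ p ≤ T u k ∧ T u k ≤ M * T (timeShiftTest 4 (-1) u) k) →
    (∃ (s : ℕ) (C₀ C₁ : ℝ), ∀ (n : ℕ)
        (F : Fin n → {q : Fin 4 × Fin 4 // q.1 < q.2} → 𝓢(EuclideanSpace ℝ (Fin 4), ℝ)),
      (∀ i, ∑ q, schwartzNorm s (ofRealTest (F i q)) ≤ 1) →
      (∀ i j, i ≠ j → ∀ q q', Disjoint (tsupport (F i q)) (tsupport (F j q'))) →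
      ∀ k : ℕ, |∫ U, ∏ i, ∑ q : {q : Fin 4 × Fin 4 // q.1 < q.2},
        smearedLatticeField (plaquetteObs r.ρ 0 q.1.1 q.1.2)
          (Literature.Probability.LatticeModels.box 4 (canon.L k)) (canon.a k) (canon.c r.curvature k)
          (canon.m r.curvature k / 6) (F i q) (torusLift (canon.side k) U)
        ∂(wilsonMeasure r.ρ (canon.β k) : Measure (GaugeConfig 4 (canon.side k) G))| ≤
        C₀ * C₁ ^ n * n.factorial) →
    (∃ (f g h : 𝓢(EuclideanSpace ℝ (Fin 4), ℝ)) (δ : ℝ),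
      Disjoint (tsupport f) (tsupport g) ∧ Disjoint (tsupport f) (tsupport h) ∧
      Disjoint (tsupport g) (tsupport h) ∧ 0 < δ ∧
      ∀ᶠ k in Filter.atTop, δ ≤
        |latticeSchwinger r.ρ canon (fun s => s.F) k 3 (fun _ => r.curvature) ![f, g, h] -
          latticeSchwinger r.ρ canon (fun s => s.F) k 1 (fun _ => r.curvature) ![f] *
            latticeSchwinger r.ρ canon (fun s => s.F) k 2 (fun _ => r.curvature) ![g, h] -
          latticeSchwinger r.ρ canon (fun s => s.F) k 1 (fun _ => r.curvature) ![g] *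
            latticeSchwinger r.ρ canon (fun s => s.F) k 2 (fun _ => r.curvature) ![f, h] -
          latticeSchwinger r.ρ canon (fun s => s.F) k 1 (fun _ => r.curvature) ![h] *
            latticeSchwinger r.ρ canon (fun s => s.F) k 2 (fun _ => r.curvature) ![f, g] +
          2 * (latticeSchwinger r.ρ canon (fun s => s.F) k 1 (fun _ => r.curvature) ![f] *
            latticeSchwinger r.ρ canon (fun s => s.F) k 1 (fun _ => r.curvature) ![g] *
            latticeSchwinger r.ρ canon (fun s => s.F) k 1 (fun _ => r.curvature) ![h])|) →
    ∃ (sch' : SpeciesScheme (YMSpecies G)) (S₁ : SchwingerFamily (EuclideanSpace ℝ (Fin 4))),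
      sch'.HasWeakCouplingLimit ∧ OneFieldClauses r sch' S₁ := by
  intro bare T canon hw hpv hΔ hgap hC1 hmono habs hu hfw hUMB hK3
  -- the tail `k ≥ k₀`: floor ∧ window, and `a_k ≤ 1`
  have ha1 : ∀ᶠ k in atTop, sch.a k ≤ 1 := sch.tendsto_a.eventually_le_const zero_lt_one
  obtain ⟨k₀, hk₀⟩ := Filter.eventually_atTop.1 (hfw.and ha1)
  have hTpos : ∀ k, k₀ ≤ k → 0 < T u k := fun k hk =>
    (pow_pos (sch.a_pos k) p).trans_le (hk₀ k hk).1.1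
  -- the seam identity for the self-normalised scheme: `T^canon_k(u, θu) = 1` on the tail
  have hone : ∀ k, k₀ ≤ k →
      latticeSchwinger r.ρ canon (fun s => s.F) k (1 + 1) (fun _ => r.curvature) ![u, thetaTest 4 u] -
          latticeSchwinger r.ρ canon (fun s => s.F) k 1 (fun _ => r.curvature) ![u] *
            latticeSchwinger r.ρ canon (fun s => s.F) k 1 (fun _ => r.curvature) ![thetaTest 4 u] = 1 := by
    intro k hk
    rw [trunc_rescale r canon k u (thetaTest 4 u)]
    have hc : canon.c r.curvature k = (Real.sqrt (T u k))⁻¹ := rfl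
    have hb : latticeSchwinger r.ρ ({ canon with c := fun _ _ => 1, m := fun _ _ => 0 } :
          SpeciesScheme (YMSpecies G)) (fun s => s.F) k (1 + 1) (fun _ => r.curvature) ![u, thetaTest 4 u] -
        latticeSchwinger r.ρ ({ canon with c := fun _ _ => 1, m := fun _ _ => 0 } :
            SpeciesScheme (YMSpecies G)) (fun s => s.F) k 1 (fun _ => r.curvature) ![u] *
          latticeSchwinger r.ρ ({ canon with c := fun _ _ => 1, m := fun _ _ => 0 } :
            SpeciesScheme (YMSpecies G)) (fun s => s.F) k 1 (fun _ => r.curvature) ![thetaTest 4 u] =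
        T u k := rfl
    rw [hc, hb, inv_pow, Real.sq_sqrt (hTpos k hk).le, inv_mul_cancel₀ (hTpos k hk).ne']
  -- the infrared inputs of `canon`: (a), (b) from `sch` (definitionally those of `canon`); (c) the identity; (d) the hypothesis
  have hgap' : HasLatticeMassGap r canon Δ := hgap
  have hfloor : ∀ᶠ k in atTop, (1 : ℝ) ≤
      |latticeSchwinger r.ρ canon (fun s => s.F) k (1 + 1) (fun _ => r.curvature) ![u, thetaTest 4 u] -
        latticeSchwinger r.ρ canon (fun s => s.F) k 1 (fun _ => r.curvature) ![u] *
          latticeSchwinger r.ρ canon (fun s => s.F) k 1 (fun _ => r.curvature) ![thetaTest 4 u]| :=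
    Filter.eventually_atTop.2 ⟨k₀, fun k hk => by rw [hone k hk, abs_one]⟩
  obtain ⟨f₃, g₃, h₃, δ₃, hfg, hfh, hgh, hδ₃, hK3'⟩ := hK3
  -- the tail sub-scheme
  have hφ : StrictMono fun k : ℕ => k + k₀ := fun a b h => Nat.add_lt_add_right h k₀
  refine oneFieldClauses_of_uniformMonomials r (subseq canon (fun k => k + k₀) hφ)
    (hasWeakCouplingLimit_subseq canon _ hφ hw) (polyVolume_subseq canon _ hφ hpv) ?_ ?_
    (uniformMomentBoundsPlanes_subseq r canon _ hφ hUMB) hΔ (hasLatticeMassGap_subseq r canon _ hφ hgap') Cmono hC1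
    (fun n d q y hy s k j hj => hmono n d q y hy s (k + k₀) j hj)
    (fun n ρ => (habs n ρ).comp hφ.tendsto_atTop)
    ⟨u, thetaTest 4 u, 1, hu, tsupport_thetaTest_pos' hu, one_pos, eventually_subseq hφ hfloor⟩
    ⟨f₃, g₃, h₃, δ₃, hfg, hfh, hgh, hδ₃, eventually_subseq hφ hK3'⟩
  · -- `PolyRenorm` on the tail: `|c'_k| = 1/√T⁰_k ≤ a_k⁻ᵖ`
    refine ⟨p, fun k => ?_⟩
    show |(Real.sqrt (T u (k + k₀)))⁻¹| ≤ (sch.a (k + k₀))⁻¹ ^ p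
    obtain ⟨⟨hfl, -⟩, hak⟩ := hk₀ (k + k₀) (Nat.le_add_left k₀ k)
    have hT : 0 < T u (k + k₀) := hTpos _ (Nat.le_add_left k₀ k)
    have ha : 0 < sch.a (k + k₀) := sch.a_pos _
    rw [abs_of_pos (inv_pos.2 (Real.sqrt_pos.2 hT)), inv_pow]
    refine inv_anti₀ (pow_pos ha p) (Real.le_sqrt_of_sq_le ?_)
    calc (sch.a (k + k₀) ^ p) ^ 2 = sch.a (k + k₀) ^ p * sch.a (k + k₀) ^ p := sq _
      _ ≤ sch.a (k + k₀) ^ p * 1 :=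
        mul_le_mul_of_nonneg_left (pow_le_one₀ ha.le hak) (pow_nonneg ha.le p)
      _ ≤ T u (k + k₀) := by rw [mul_one]; exact hfl
  · -- bounded counterterm: `|m'_k| ≤ sup |tr F²|`
    obtain ⟨Cm, hCm⟩ := r.curvature.bounded
    refine ⟨Cm, fun k => ?_⟩
    show |∫ U, r.curvature.F (torusLift (sch.side (k + k₀)) U)
        ∂(wilsonMeasure r.ρ (sch.β (k + k₀)) : Measure (GaugeConfig 4 (sch.side (k + k₀)) G))| ≤ Cm
    haveI : IsProbabilityMeasure
        (wilsonMeasure (d := 4) (L := sch.side (k + k₀)) (G := G) r.ρ (sch.β (k + k₀))) :=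
      isProbabilityMeasure_wilsonMeasure r.ρ r.continuous _
    have h := norm_integral_le_of_norm_le_const
      (μ := (wilsonMeasure r.ρ (sch.β (k + k₀)) : Measure (GaugeConfig 4 (sch.side (k + k₀)) G)))
      (f := fun U => r.curvature.F (torusLift (sch.side (k + k₀)) U)) (C := Cm)
      (ae_of_all _ fun U => by rw [Real.norm_eq_abs]; exact hCm _)
    simpa using h


end Seam

/-- **`stub_oneFieldClausesUniform`** (registered sub-goal of line `registered`, reshape 6 — the closure step, closed form of
`oneFieldClauses_of_uniformMonomials`): a weak-coupling scheme with polynomial volume growth and renormalisation, bounded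
counterterms, the `k`-uniform plane-resolved `n!`-moment bounds, the uniform lattice gap, the UNIFORM monomial constants
absorbed by the volumes and the two floors yield a sub-scheme at weak coupling with the one-field clauses. [folklore] -/
theorem stub_oneFieldClausesUniform :
    ∀ (G : Type) [Group G] [TopologicalSpace G] [IsTopologicalGroup G] [CompactSpace G] [MeasurableSpace G]
      [BorelSpace G] (r : LatticeRep G) (sch : SpeciesScheme (YMSpecies G)) (Δ : ℝ) (Cmono : ℕ → ℕ → ℝ),
      sch.HasWeakCouplingLimit → PolyVolume sch → PolyRenorm r sch → (∃ Cm : ℝ, ∀ k, |sch.m r.curvature k| ≤ Cm) →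
      UniformMomentBoundsPlanes r sch → 0 < Δ → HasLatticeMassGap r sch Δ → (∀ n d, 1 ≤ Cmono n d) →
      (∀ (n d : ℕ) (q : Fin n → Fin 4 × Fin 4) (y : Fin n → Literature.Probability.LatticeModels.Site 4),
        (∀ l, (0 ≤ y l 0 ∧ y l 0 ≤ (d : ℤ)) ∧ ∀ i : Fin 4, i ≠ 0 → |y l i| ≤ (d : ℤ)) →
        ∀ (s : Finset (Fin n)) (k j : ℕ), j ≤ sch.L k →
          latticeConnectedCorr r.ρ (sch.β k) (2 * sch.L k + 1)
              ((fun V => ∏ l ∈ s, plane G r (q l) (y l) V) ∘ gaugeTimeReflect)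
              (fun V => ∏ l ∈ s, plane G r (q l) (y l) V) j ≤ Cmono n d * Real.exp (-(Δ * sch.a k * j))) →
      (∀ n ρ : ℕ, Tendsto (fun k => (Real.log (Cmono n (⌊(ρ : ℝ) / sch.a k⌋₊ + 2)) + |Real.log (sch.a k)|) /
        (sch.a k * (sch.L k : ℝ))) atTop (𝓝 0)) →
      (∃ (u v : 𝓢(EuclideanSpace ℝ (Fin 4), ℝ)) (δ : ℝ),
      tsupport u ⊆ {y : EuclideanSpace ℝ (Fin 4) | y 0 < 0} ∧
      tsupport v ⊆ {y : EuclideanSpace ℝ (Fin 4) | 0 < y 0} ∧ 0 < δ ∧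
      ∀ᶠ k in atTop, δ ≤
        |latticeSchwinger r.ρ sch (fun s => s.F) k (1 + 1) (fun _ => r.curvature) ![u, v] -
          latticeSchwinger r.ρ sch (fun s => s.F) k 1 (fun _ => r.curvature) ![u] *
            latticeSchwinger r.ρ sch (fun s => s.F) k 1 (fun _ => r.curvature) ![v]|) →
      (∃ (f g h : 𝓢(EuclideanSpace ℝ (Fin 4), ℝ)) (δ : ℝ),
      Disjoint (tsupport f) (tsupport g) ∧ Disjoint (tsupport f) (tsupport h) ∧
      Disjoint (tsupport g) (tsupport h) ∧ 0 < δ ∧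
      ∀ᶠ k in atTop, δ ≤
        |latticeSchwinger r.ρ sch (fun s => s.F) k 3 (fun _ => r.curvature) ![f, g, h] -
          latticeSchwinger r.ρ sch (fun s => s.F) k 1 (fun _ => r.curvature) ![f] *
            latticeSchwinger r.ρ sch (fun s => s.F) k 2 (fun _ => r.curvature) ![g, h] -
          latticeSchwinger r.ρ sch (fun s => s.F) k 1 (fun _ => r.curvature) ![g] *
            latticeSchwinger r.ρ sch (fun s => s.F) k 2 (fun _ => r.curvature) ![f, h] -
          latticeSchwinger r.ρ sch (fun s => s.F) k 1 (fun _ => r.curvature) ![h] *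
            latticeSchwinger r.ρ sch (fun s => s.F) k 2 (fun _ => r.curvature) ![f, g] +
          2 * (latticeSchwinger r.ρ sch (fun s => s.F) k 1 (fun _ => r.curvature) ![f] *
            latticeSchwinger r.ρ sch (fun s => s.F) k 1 (fun _ => r.curvature) ![g] *
            latticeSchwinger r.ρ sch (fun s => s.F) k 1 (fun _ => r.curvature) ![h])|) →
      ∃ (sch' : SpeciesScheme (YMSpecies G)) (S₁ : SchwingerFamily (EuclideanSpace ℝ (Fin 4))),
        sch'.HasWeakCouplingLimit ∧ OneFieldClauses r sch' S₁ :=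
  fun _ _ _ _ _ _ _ r sch _ Cmono hw hpv hpr hbm hUMB hΔ hgap hC1 hmono habs hNT hNG =>
    oneFieldClauses_of_uniformMonomials r sch hw hpv hpr hbm hUMB hΔ hgap Cmono hC1 hmono habs hNT hNG

end Summit.QuantumFields.YangMills.Theorems.ContinuumFromLatticeGap

end
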